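import Summits.NavierStokesRegularity.NavierStokesRegularity.Theses.TypeICertificateLadder
import Summits.NavierStokesRegularity.NavierStokesRegularity.Theorems.TypeICertificateLadderTargetRateClassLiouville
import Literature.Analysis.FluidPDE.TypeIAncientMild
import HarnessLib.Audit

/-!
# Strategist sketch — crux `Target` ≡ `TypeICertificateLadder.NoTypeIBlowup` (stmt-NavierStokesRegularity-1217)

Typed forms of the statements quoted in `STRATEGY-CENSUS.md` (unit cstrat-stmt-NavierStokesRegularity-1217,
2026-08-16). Nothing here is filed as an item; the file only certifies that the census signatures elaborate
over existing declarations. `sorry` is not used; the only theorems are bookkeeping implications.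
-/

noncomputable section

set_option linter.unusedVariables false
set_option linter.dupNamespace false

open Set Filter MeasureTheory Metric
open scoped Topology

namespace Summit.NavierStokesRegularity.NavierStokesRegularity.Cruxes.Target.Strategist

local notation "ℝ³" => EuclideanSpace ℝ (Fin 3)

open Literature.Analysis.FluidPDE

/-- The crux, by name. -/
abbrev Crux : Prop :=
  Summit.NavierStokesRegularity.NavierStokesRegularity.Theses.TypeICertificateLadder.NoTypeIBlowup

/-! ## Strengthen -/

/-- S⁺₀ — RATE-CLASS LIOUVILLE (the working strengthening every line uses; hypothesis of the landed
`Theorems.noTypeIBlowup_of_rateClassLiouville`, p94280). -/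
def RateClassLiouville : Prop :=
  ∀ C : ℝ, 0 < C → ∀ u : ℝ → ℝ³ → ℝ³, IsTypeIAncientMild C u → ∀ t < 0, ∀ x, u t x = 0

/-- S⁺₀ feeds the crux (tree theorem, one line). -/
theorem crux_of_rateClassLiouville (h : RateClassLiouville) : Crux :=
  Summit.NavierStokesRegularity.NavierStokesRegularity.Theorems.noTypeIBlowup_of_rateClassLiouville h

/-- S⁺_rec — RECURRENT CONCENTRATED CORE LIOUVILLE (mild-class transcription of
`RecurrentProfiles.RecurrentLiouville`, stmt-1589): no element of the rate class that is (a) concentrated at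
the origin at every time, scale-invariantly in `L³`, and (b) uniformly recurrent under the parabolic scaling
`u ↦ λu(λ·,λ²·)` in `C⁰_loc`, other than zero. Weaker than S⁺₀ as a statement (extra hypotheses), fed INTO
the crux by compactness + Birkhoff + `TypeIConcentration` (census §Decomposition (c)). -/
def RecurrentCoreLiouville : Prop :=
  ∀ C ρ γ : ℝ, 0 < C → 0 < ρ → 0 < γ → ∀ u : ℝ → ℝ³ → ℝ³, IsTypeIAncientMild C u →
    (∀ t < 0, γ ≤ ∫ x in ball (0 : ℝ³) (ρ * Real.sqrt (-t)), ‖u t x‖ ^ 3) →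
    (∀ ε R : ℝ, 0 < ε → 1 < R → ∃ L : ℝ, 0 < L ∧ ∀ a : ℝ, ∃ σ ∈ Icc a (a + L),
        ∀ t ∈ Icc (-R) (-R⁻¹), ∀ x : ℝ³, ‖x‖ ≤ R →
          ‖Real.exp σ • u (Real.exp (2 * σ) * t) (Real.exp σ • x) - u t x‖ ≤ ε) →
    ∀ t < 0, ∀ x, u t x = 0

/-- S⁺₀ ⇒ S⁺_rec (trivial direction; the converse is the content of the reduction). -/
theorem recurrentCoreLiouville_of_rateClassLiouville (h : RateClassLiouville) : RecurrentCoreLiouville :=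
  fun C ρ γ hC _ _ u hu _ _ => h C hC u hu

/-- S⁺_st — SPACE-TIME TYPE-I LIOUVILLE (Pineau–Vicol's standing hypothesis class (1.10), all of it):
rate-class elements with the apex bound `‖u(t,x)‖ ≤ C/(‖x‖ + √(−t))` vanish. Contains the self-similar
(NRŠ/Tsai), `λ`-DSS-with-decay and RSS strata; open at `α ≈ 1` / large `λ`. -/
def SpaceTimeTypeILiouville : Prop :=
  ∀ C : ℝ, 0 < C → ∀ u : ℝ → ℝ³ → ℝ³, IsTypeIAncientMild C u →
    (∀ t < 0, ∀ x, ‖u t x‖ ≤ C / (‖x‖ + Real.sqrt (-t))) → ∀ t < 0, ∀ x, u t x = 0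

theorem spaceTimeTypeILiouville_of_rateClassLiouville (h : RateClassLiouville) : SpaceTimeTypeILiouville :=
  fun C hC u hu _ => h C hC u hu

/-! ## Decomposition (d): non-spreading ∧ space-time Liouville -/

/-- Sub₁ of split (d) — NON-SPREADING AT SOME SINGULAR POINT: a Type-I(C) solution of the crux's class
which does not extend has a point `x₀` and constants `C', R` with the space–time Type-I bound
`(‖x − x₀‖ + √(ν(T−t))) ‖u(t,x)‖ ≤ C' ν` on `‖x − x₀‖ < R`, `t` near `T`. UNFOUNDED (census: the energy
class allows `≍ (T−t)^{-1/2}` unit-profile bubbles inside radius `≍ (T−t)^{1/3}`; satellites are not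
excluded by any known estimate) — recorded as a signature only. -/
def NonSpreadingAtSomeSingularPoint : Prop :=
  ∀ C : ℝ, 0 < C → ∀ (ν T : ℝ), 0 < ν → 0 < T → ∀ (u : ℝ → ℝ³ → ℝ³) (p : ℝ → ℝ³ → ℝ),
    IsClassicalNSSolutionOn (Ico 0 T) ν 0 u p → IsLerayHopfOn T ν 0 (u 0) u →
    HasRapidSpatialDecay (u 0) →
    (∀ᶠ t in 𝓝[<] T, ∀ x, Real.sqrt (T - t) * ‖u t x‖ ≤ C * Real.sqrt ν) →
    ¬ HasSmoothExtensionPast ν 0 u T →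
    ∃ x₀ : ℝ³, ∃ C' R : ℝ, 0 < R ∧ ∀ᶠ t in 𝓝[<] T, ∀ x : ℝ³, ‖x - x₀‖ < R →
      (‖x - x₀‖ + Real.sqrt (ν * (T - t))) * ‖u t x‖ ≤ C' * ν

/-- Glue of split (d), as a statement (the zoom at `x₀` with the apex bound inherited; M-sized on top of
the landed `Theorems.stub_typeIZoom`, NOT proved here). -/
def SplitDGlue : Prop :=
  NonSpreadingAtSomeSingularPoint → SpaceTimeTypeILiouville → Crux

/-! ## Decomposition (e): amplitude bands (generalised descent) -/

/-- DESCENT FROM LEVEL `C₂` TO LEVEL `C₁` (generalises the filed support `DescentToRungOne`, stmt-14842,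
which is the case `C₁ = 1`): a Type-I(`C₂`) singular solution eventually has collapse Reynolds number
`≤ C₁`. With the rung `X_{C₁}` it gives `X_{C₂}`. Every band is open; the top band is Euler-hard. -/
def DescentBand (C₁ C₂ : ℝ) : Prop :=
  ∀ (ν T : ℝ), 0 < ν → 0 < T → ∀ (u : ℝ → ℝ³ → ℝ³) (p : ℝ → ℝ³ → ℝ),
    IsClassicalNSSolutionOn (Ico 0 T) ν 0 u p → IsLerayHopfOn T ν 0 (u 0) u →
    HasRapidSpatialDecay (u 0) →
    (∀ᶠ t in 𝓝[<] T, ∀ x, Real.sqrt (T - t) * ‖u t x‖ ≤ C₂ * Real.sqrt ν) →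
    ¬ HasSmoothExtensionPast ν 0 u T →
    ∀ᶠ t in 𝓝[<] T, ∀ x, Real.sqrt (T - t) * ‖u t x‖ ≤ C₁ * Real.sqrt ν

/-- The rung statement `X_C` (shape pinned by `LadderGlue`). -/
def Rung (C : ℝ) : Prop :=
  ∀ (ν T : ℝ), 0 < ν → 0 < T → ∀ (u : ℝ → ℝ³ → ℝ³) (p : ℝ → ℝ³ → ℝ),
    IsClassicalNSSolutionOn (Ico 0 T) ν 0 u p → IsLerayHopfOn T ν 0 (u 0) u →
    HasRapidSpatialDecay (u 0) →
    (∀ᶠ t in 𝓝[<] T, ∀ x, Real.sqrt (T - t) * ‖u t x‖ ≤ C * Real.sqrt ν) →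
    HasSmoothExtensionPast ν 0 u T

/-- Band bookkeeping: rung `C₁` and descent `C₂ ↘ C₁` give rung `C₂` (pure logic). -/
theorem rung_of_rung_of_descentBand {C₁ C₂ : ℝ} (h₁ : Rung C₁) (hd : DescentBand C₁ C₂) : Rung C₂ := by
  intro ν T hν hT u p hcl hLH hdec hrate
  by_contra hext
  exact hext (h₁ ν T hν hT u p hcl hLH hdec (hd ν T hν hT u p hcl hLH hdec hrate hext))

/-- All rungs give the crux (the filed `LadderGlue`, proved in tree). -/
theorem crux_of_all_rungs (h : ∀ C : ℝ, 0 < C → Rung C) : Crux :=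
  Summit.NavierStokesRegularity.NavierStokesRegularity.Theses.TypeICertificateLadder.LadderGlue_holds h

/-- Band form of the ladder: one rung `X_{C₁}` plus descent from every higher level closes the crux
(with `C₁ = 1` this is exactly `RungOneSplice`, stmt-14843, proved in tree). -/
theorem crux_of_rung_of_descent {C₁ : ℝ} (hC₁ : 0 < C₁) (h₁ : Rung C₁)
    (hd : ∀ C₂ : ℝ, C₁ ≤ C₂ → DescentBand C₁ C₂) : Crux := by
  refine crux_of_all_rungs fun C hC => ?_
  intro ν T hν hT u p hcl hLH hdec hrate
  have hrate' : ∀ᶠ t in 𝓝[<] T, ∀ x, Real.sqrt (T - t) * ‖u t x‖ ≤ max C C₁ * Real.sqrt ν := by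
    filter_upwards [hrate] with t ht x
    exact (ht x).trans (mul_le_mul_of_nonneg_right (le_max_left _ _) (Real.sqrt_nonneg _))
  exact rung_of_rung_of_descentBand h₁ (hd (max C C₁) (le_max_right _ _)) ν T hν hT u p hcl hLH hdec hrate'

end Summit.NavierStokesRegularity.NavierStokesRegularity.Cruxes.Target.Strategist

end
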